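import Summits.Ventures.HodgeRepro2.T5LandherrInvariants
import Summits.Ventures.HodgeRepro2.T6N2Contract3

/-!
# N2's conclusion `Adm` from the Hasse-principle display — seat t6-p5's Lemma N.2 on the datum with
`Shimura2008_Thm2_2_i` replaced by `GrossBH2021_Thm3_1_uniqueness` (cell pub-hodge-repro2, seat p3)

Tier-5 N2 support, rows N2.2.7 / N2.2.9 / N2.8.1 of route/T5-N2-route-3.md; consumer-side plumbing of file 161.
Seat t6-p5's T6N2Main proves LEMMA N.2 on the datum — `N2Main.adm_of D hfr h₁₁₁ h₁₀₀ hu hSh : D.Adm` (the four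
`ε_i` μ-admissible, `W_B ≅ W_A`, (H_χ)) — with ONE display, `T6.Hyp.Shimura2008_Thm2_2_i K` (Landherr's
classification by `(n, {σ_v}, d₀)`), applied to the hermitian forms `W_A / e₁₁₁ = ⟨1, r⟩` and
`W_B / e₁₁₁ = ⟨u, u⁻¹ r⟩`, which have the SAME determinant `r` and the same indices (`N2Main.index_eq`). File 161
derives that display from the Hasse-principle display `T5HermitianGlobalChain.GrossBH2021_Thm3_1_uniqueness K (Fin 2)`
(`shimura2008_Thm2_2_i_of_grossBH2021`). This file composes the two: every N2 conclusion of t6-p5's chain is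
restated with the Hasse-principle display as its only non-kernel input — on the datum (`isIsometric_of_hasse`,
`adm_of_hasse`), on the explicit datum of §N2.1(b) (`ofSpec_adm_hasse`), and over the lead's composition carriers
(`N2_main_hasse` / `N2_main_ofSpec_hasse : M.AdmDatum` on `NAut2`, `N2_main₃_hasse` on the re-cut `NAut3`) —
exactly t6-p5's `N2_main` / `N2_main_ofSpec` / `N2_main₃` with `hSh` replaced by `hLandherr`: all SIX consumers of
the display `Shimura2008_Thm2_2_i` in the cell's tree (probe CONSUMERS-Landherr-g70.txt: `N2Main.isIsometric_of`,
`adm_of`, `ofSpec_adm`, `N2Contract.N2_main`, `N2_main_ofSpec`, `N2Contract3.N2_main₃`; the M3 root does not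
reference it) restated on the Hasse-principle display. On the datum's forms the determinant ratio is `1`, so
file 161's local step is the trivial symbol `(1, θ)_v = 1`: the selection rule, `|D| ≤ 1` and Hilbert reciprocity
of file 156's chain play no part here.

Nothing here is new mathematics: every proof is t6-p5's theorem applied to file 161's display implication.
Mathlib + t6-p5's ACCEPTED T6N2Main / T6N2Contract / T6N2Contract3 (consumed by name, never re-declared) + file
161; no new display; no device. §8(d): uses an L-value-free non-vanishing device: NO.
-/

namespace Summit.Ventures.HodgeRepro2.T5N2AdmHasse

open Summit.Ventures.HodgeRepro2
open Summit.Ventures.HodgeRepro2.T6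
open Summit.Ventures.HodgeRepro2.T5DatumSimilitude
open Summit.Ventures.HodgeRepro2.T5CubeTypes
open Summit.Ventures.HodgeRepro2.T5HermitianGlobalChain
open Summit.Ventures.HodgeRepro2.T5LandherrInvariants

open IsDedekindDomain NumberField

variable {K : Type*} [Field K] [NumberField K] [NumberField.IsCMField K]
variable {F : FaceSetting K} {P : NDatum F} {𝒟 : N3Datum}

/-! ### On the datum the determinant ratio is `1`: rows N2.8.1 (i)–(ii) need no input -/

/-- **Lemma N.1's local chain on the datum of record is trivial:** the two hermitian Gram matrices of t6-p5's
proof — `diag(1, r)` for `W_A / e₁₁₁` and `diag(u, u⁻¹ r)` for `W_B / e₁₁₁` — have the same determinant `r`, so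
they are congruent over `K⁺_v ⊗ K` at EVERY finite place `v` of `K⁺` with no input at all (the symbol is
`(1, θ)_v = 1`): no selection rule, no `|D| ≤ 1`, no Hilbert reciprocity. -/
theorem locallyCongruent_datum_all (D : N2Datum F P 𝒟)
    (h₁₁₁ : IsLiuSignElement K (D.type t111) D.e₁₁₁)
    (h₁₀₀ : IsLiuSignElement K (D.type t100) D.e₁₀₀) (hu : N2Main.USpec D)
    (v : HeightOneSpectrum (𝓞 (maximalRealSubfield K))) :
    LocallyCongruent K v (Matrix.diagonal ![D.u, D.u⁻¹ * N2Main.rCoeff D])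
      (Matrix.diagonal ![1, N2Main.rCoeff D]) := by
  have hr := N2Main.star_rCoeff D h₁₁₁.1 h₁₀₀.1
  have hr0 : N2Main.rCoeff D ≠ 0 := mul_ne_zero h₁₀₀.2.1 (inv_ne_zero h₁₁₁.2.1)
  have hu0 := hu.2.1
  have hsu : star (D.u⁻¹ * N2Main.rCoeff D) = D.u⁻¹ * N2Main.rCoeff D := by
    rw [star_mul, T5DatumCMField.star_inv_of_star_eq hu.1, hr, mul_comm]
  have hH : (Matrix.diagonal ![D.u, D.u⁻¹ * N2Main.rCoeff D]).IsHermitian := by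
    refine Matrix.isHermitian_diagonal_iff.mpr fun i => ?_
    fin_cases i
    · exact hu.1
    · exact hsu
  have hH' : (Matrix.diagonal ![(1 : K), N2Main.rCoeff D]).IsHermitian := by
    refine Matrix.isHermitian_diagonal_iff.mpr fun i => ?_
    fin_cases i
    · exact star_one K
    · exact hr
  have hdet : IsUnit (Matrix.diagonal ![D.u, D.u⁻¹ * N2Main.rCoeff D]).det := by
    rw [Matrix.det_diagonal, Fin.prod_univ_two]
    simp [hu0, hr0]
  have hdet' : IsUnit (Matrix.diagonal ![(1 : K), N2Main.rCoeff D]).det := by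
    rw [Matrix.det_diagonal, Fin.prod_univ_two]
    simp [hr0]
  have hdeq : (Matrix.diagonal ![(1 : K), N2Main.rCoeff D]).det =
      (Matrix.diagonal ![D.u, D.u⁻¹ * N2Main.rCoeff D]).det := by
    rw [Matrix.det_diagonal, Matrix.det_diagonal, Fin.prod_univ_two, Fin.prod_univ_two]
    simp only [Matrix.cons_val_zero, Matrix.cons_val_one]
    rw [one_mul, ← mul_assoc, mul_inv_cancel₀ hu0, one_mul]
  exact locallyCongruent_all_of_det_eq' hH hH' hdet hdet' hdeq v

/-! ### On the datum -/

/-- (b2) `W_B ≅ W_A` from the Hasse-principle display: t6-p5's `N2Main.isIsometric_of` with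
`Shimura2008_Thm2_2_i K` supplied by file 161. -/
theorem isIsometric_of_hasse (D : N2Datum F P 𝒟) (hfr : IsCMFrame D.τ)
    (h₁₁₁ : IsLiuSignElement K (D.type t111) D.e₁₁₁)
    (h₁₀₀ : IsLiuSignElement K (D.type t100) D.e₁₀₀) (hu : N2Main.USpec D)
    (hLandherr : GrossBH2021_Thm3_1_uniqueness K (Fin 2)) : D.IsIsometric :=
  N2Main.isIsometric_of D hfr h₁₁₁ h₁₀₀ hu (shimura2008_Thm2_2_i_of_grossBH2021 hLandherr)

/-- LEMMA N.2 ON THE DATUM from the Hasse-principle display: `D.Adm` — the four `ε_i` μ-admissible,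
`W_B ≅ W_A`, (H_χ) — with `GrossBH2021_Thm3_1_uniqueness K (Fin 2)` as the only non-kernel input. -/
theorem adm_of_hasse (D : N2Datum F P 𝒟) (hfr : IsCMFrame D.τ)
    (h₁₁₁ : IsLiuSignElement K (D.type t111) D.e₁₁₁)
    (h₁₀₀ : IsLiuSignElement K (D.type t100) D.e₁₀₀) (hu : N2Main.USpec D)
    (hLandherr : GrossBH2021_Thm3_1_uniqueness K (Fin 2)) : D.Adm :=
  N2Main.adm_of D hfr h₁₁₁ h₁₀₀ hu (shimura2008_Thm2_2_i_of_grossBH2021 hLandherr)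

/-- LEMMA N.2 («the explicit datum meets it», §N2.1(b)) from the Hasse-principle display: t6-p5's
`N2Main.ofSpec_adm` with the display replaced. -/
theorem ofSpec_adm_hasse (F : FaceSetting K) (P : NDatum F) (𝒟 : N3Datum)
    {τ : Fin 3 → (K →+* ℂ)} (hfr : IsCMFrame τ) {e₁₁₁ e₁₀₀ : K}
    (h₁₁₁ : IsLiuSignElement K (cubeType τ t111) e₁₁₁)
    (h₁₀₀ : IsLiuSignElement K (cubeType τ t100) e₁₀₀)
    (Char : Type) [CommGroup Char] (χ₁₁₁ χ₁₀₀ : Char)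
    (admA : Set 𝒟.A.Sa) (admB : Set 𝒟.A.Sb) (admC : Set 𝒟.B.Sa) (admD : Set 𝒟.B.Sb)
    (hLandherr : GrossBH2021_Thm3_1_uniqueness K (Fin 2)) :
    (N2Main.ofSpec F P 𝒟 hfr h₁₁₁ h₁₀₀ Char χ₁₁₁ χ₁₀₀ admA admB admC admD).Adm :=
  N2Main.ofSpec_adm F P 𝒟 hfr h₁₁₁ h₁₀₀ Char χ₁₁₁ χ₁₀₀ admA admB admC admD
    (shimura2008_Thm2_2_i_of_grossBH2021 hLandherr)

/-! ### Over the lead's composition carriers -/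

/-- `N2_main_ofSpec` over the v2 carrier from the Hasse-principle display: t6-p5's `N2Contract.N2_main_ofSpec`
(the carrier's `d2` is the explicit datum `N2Main.ofSpec`) with `hSh` replaced by `hLandherr`. -/
theorem N2_main_ofSpec_hasse (M : NAut2 F P)
    {τ : Fin 3 → (K →+* ℂ)} (hfr : IsCMFrame τ) {e₁₁₁ e₁₀₀ : K}
    (h₁₁₁ : IsLiuSignElement K (cubeType τ t111) e₁₁₁)
    (h₁₀₀ : IsLiuSignElement K (cubeType τ t100) e₁₀₀)
    (Char : Type) [CommGroup Char] (χ₁₁₁ χ₁₀₀ : Char)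
    (admA : Set M.d3.A.Sa) (admB : Set M.d3.A.Sb) (admC : Set M.d3.B.Sa) (admD : Set M.d3.B.Sb)
    (hd2 : M.d2 = N2Main.ofSpec F P M.d3 hfr h₁₁₁ h₁₀₀ Char χ₁₁₁ χ₁₀₀ admA admB admC admD)
    (hLandherr : GrossBH2021_Thm3_1_uniqueness K (Fin 2)) : M.AdmDatum :=
  N2Contract.N2_main_ofSpec M hfr h₁₁₁ h₁₀₀ Char χ₁₁₁ χ₁₀₀ admA admB admC admD hd2
    (shimura2008_Thm2_2_i_of_grossBH2021 hLandherr)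

/-- `N2_main` over the v2 carrier `NAut2` (TARGET-T6 §9.3) from the Hasse-principle display: t6-p5's
`N2Contract.N2_main` with `hSh` replaced by `hLandherr`. -/
theorem N2_main_hasse (M : NAut2 F P) (hfr : IsCMFrame M.d2.τ)
    (h₁₁₁ : IsLiuSignElement K (M.d2.type t111) M.d2.e₁₁₁)
    (h₁₀₀ : IsLiuSignElement K (M.d2.type t100) M.d2.e₁₀₀)
    (hu : N2Main.USpec M.d2)
    (hLandherr : GrossBH2021_Thm3_1_uniqueness K (Fin 2)) : M.AdmDatum :=
  N2Contract.N2_main M hfr h₁₁₁ h₁₀₀ hu (shimura2008_Thm2_2_i_of_grossBH2021 hLandherr)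

/-- `N2_main₃` over the re-cut carrier `NAut3` from the Hasse-principle display: t6-p5's
`N2Contract3.N2_main₃` with `hSh` replaced by `hLandherr`. -/
theorem N2_main₃_hasse (M : NAut3 F P) (hfr : IsCMFrame M.d2.τ)
    (h₁₁₁ : IsLiuSignElement K (M.d2.type t111) M.d2.e₁₁₁)
    (h₁₀₀ : IsLiuSignElement K (M.d2.type t100) M.d2.e₁₀₀)
    (hu : N2Main.USpec M.d2)
    (hLandherr : GrossBH2021_Thm3_1_uniqueness K (Fin 2)) : M.AdmDatum :=
  N2Contract3.N2_main₃ M hfr h₁₁₁ h₁₀₀ hu (shimura2008_Thm2_2_i_of_grossBH2021 hLandherr)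

end Summit.Ventures.HodgeRepro2.T5N2AdmHasse
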